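import Summits.BirchSwinnertonDyer.BirchSwinnertonDyer.Theorems.SchneiderFreeAdditiveX3LocalTowerTorsionLineClauses
import Literature.NumberTheory.EllipticCurves.PrimaryGroupStableImage
import HarnessLib

/-!
# Fin_v WITHOUT a line: the local tower torsion is finite as soon as `E[p^∞]` carries no
# `D_𝔭`-stable divisible line and the local tower group moves some `p`-torsion point

Seat `bsd-potss-kmc`, gen 16 (cell `bsd-potss`). Helper for crux #5 `WildSplitControlAtThree` of route
`UniversalToricDescent` (stmt-BirchSwinnertonDyer-20386) — whose only residual beyond published cohomology,
after `Theorems/UniversalToricDescentWildSplitControlAtThreeOfFacts.lean` (p516040), is Fin_v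
(`SchneiderFreeControlAtoms.LocalTowerTorsionFiniteAt`: `E(K̄)[p^∞]^{D_𝔭 ⊓ ker κ}` finite) on the cell
rows WITH local `3`-torsion — and equally for the Fin_v crux `LocalTowerTorsionFiniteX3` of route
`SchneiderFreeAdditiveX3` (19546), whose kernel reductions (`…LocalTowerTorsionLine`, `…OfLine`,
`…OfUnitRoot`) all run through a CANONICAL LINE `C ≤ E[p^∞]` (pot-ordinary / pot-multiplicative
primes).  At a potentially SUPERSINGULAR prime there is no line; this file gives the line-free
reduction:

* `WeierstrassCurve.localTowerTorsionFiniteAt_of_noStableDivisibleLine` — for an elliptic `E/K`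
  (`K` a number field), a prime `p`, ANY `ℤ_p`-extension `κ` and finite place `𝔭`: IF
  (i) `E(K̄)[p^∞]` has no non-zero `D_𝔭`-stable `p`-DIVISIBLE subgroup `N` with `#N[p] ≤ p`
  (the torsion avatar of «`T_pE` has no `D_𝔭`-stable `ℤ_p`-line», i.e. of the IRREDUCIBILITY of
  `V_pE|_{G_{K_𝔭}}` — true at every prime of potentially supersingular reduction), and
  (ii) some `p`-torsion point of `E(K̄)` is moved by the local tower group `D_𝔭 ⊓ ker κ`
  (true whenever `p` is odd, `K_𝔭 = ℚ_p` and `κ` is a `ℤ_p`-extension: otherwise `D_𝔭` acts on `E[p]`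
  through the pro-`p` group `D_𝔭/(D_𝔭 ⊓ ker κ)`, by unipotents, so the Weil pairing forces `μ_p ⊂ K_𝔭`),
  THEN Fin_v holds at `(E, p, κ, 𝔭)`.
  Proof: the fixed module `B = E[p^∞]^{D_𝔭 ⊓ ker κ}` is `D_𝔭`-stable (`ker κ ⊲ Γ_K`); if it were
  infinite, its stable image `N = p^{j₀}B` (`PrimaryGroup.exists_powRange_succ_eq`) would be an infinite
  `D_𝔭`-stable `p`-divisible subgroup; `N ≠ ⊤` by (ii) (every point of `N ⊆ B` is fixed), so
  `#N[p] ≤ p` (`ncard_pTorsion_le_of_divisible_of_ne_top`, `#E[p] = p²`), and (i) gives `N = ⊥` —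
  contradiction.

Proofs only (no definition, no named fact, no `sorry`); closes nothing by itself; BSD is not advanced.
With it, hypothesis `hFinV` of `UniversalToricDescentControl.wildSplitControlAtThree_of_facts` is reduced
to the two displayed inputs (i) (local irreducibility at a pot-ss `3`, Serre 1972 / Fontaine — not yet a
tree theorem) and (ii) (Weil pairing + `ζ₃ ∉ ℚ₃` — elementary, not yet plumbed to `decomp 𝔭`).

References: [GreenbergLNM1716] §3 Lemma 3.3 (p. 87); [JetchevSkinnerWan2017] Prop. 3.3.4 Case 3(b)
(arXiv:1512.06894 p. 13); [Serre1972] §1 (local image at a pot-ss prime); L. Fuchs, *Infinite Abelian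
Groups* I §20–25 (divisible part) — background.
-/

noncomputable section

open scoped Classical AddSubgroup

namespace WeierstrassCurve

open NumberField IsDedekindDomain Field Literature.NumberTheory.EllipticCurves
  Literature.NumberTheory.EllipticCurves.GreenbergSelmer
  Summit.BirchSwinnertonDyer.BirchSwinnertonDyer.Theorems.SchneiderFreeAdditiveX3
  Summit.BirchSwinnertonDyer.BirchSwinnertonDyer.Theorems.SchneiderFreeControlAtoms

variable {K : Type} [Field K] [NumberField K] (E : WeierstrassCurve K) [E.IsElliptic] (p : ℕ)
  [hp : Fact p.Prime] (κ : ZpExtension K p) (𝔭 : HeightOneSpectrum (𝓞 K))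

/-- **Fin_v without a line.** For an elliptic curve `E` over a number field `K`, a prime `p`, a
`ℤ_p`-extension `κ` of `K` and a finite place `𝔭`: if (i) every `D_𝔭`-stable `p`-divisible subgroup
`N ≤ E(K̄)[p^∞]` with at most `p` points killed by `p` is zero (no `D_𝔭`-stable divisible LINE — the
torsion form of the irreducibility of `V_pE|_{G_{K_𝔭}}`, which holds at a prime of potentially
supersingular reduction), and (ii) the local tower group `D_𝔭 ⊓ ker κ` moves some `p`-torsion point of
`E(K̄)`, then the `p`-primary torsion of `E` fixed by `D_𝔭 ⊓ ker κ` — `E(K_{∞,w})[p^∞]` at the place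
`w ∣ 𝔭` of the chosen embedding — is finite (`SchneiderFreeControlAtoms.LocalTowerTorsionFiniteAt`).
The fixed module is `D_𝔭`-stable; were it infinite, its stable image `p^{j₀}·(fixed module)` would be
a non-zero `D_𝔭`-stable divisible subgroup, proper by (ii), hence with `≤ p` points of order `p`
(`#E[p] = p²`), against (i). [cite: GreenbergLNM1716, §3 Lemma 3.3 (p. 87)]
[cite: JetchevSkinnerWan2017, Prop. 3.3.4 Case 3(b) (arXiv:1512.06894 p. 13)] -/
theorem localTowerTorsionFiniteAt_of_noStableDivisibleLine
    (hline : ∀ N : AddSubgroup (E.geomPrimaryTorsion p),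
      (∀ d ∈ decomp 𝔭, ∀ c ∈ N, d • c ∈ N) → (∀ c ∈ N, ∃ c' ∈ N, p • c' = c) →
      Set.ncard {c : E.geomPrimaryTorsion p | c ∈ N ∧ p • c = 0} ≤ p → N = ⊥)
    (hmove : ∃ m : E.geomPrimaryTorsion p, p • m = 0 ∧
      ∃ g ∈ decomp 𝔭 ⊓ κ.kerSubgroup, g • m ≠ m) :
    LocalTowerTorsionFiniteAt E p κ 𝔭 := by
  have hpr : p.Prime := hp.out
  unfold LocalTowerTorsionFiniteAt
  set M : AddSubgroup E.geomPoints := E.geomPrimaryTorsion p with hM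
  set H : Subgroup (absoluteGaloisGroup K) := decomp 𝔭 ⊓ κ.kerSubgroup with hH
  set B : AddSubgroup M := FixedPoints.addSubgroup H M with hB
  by_contra hinf
  have hinfB : ¬ Finite B := fun h ↦ by
    haveI := h
    exact hinf (Set.toFinite _)
  -- `H` is normalised by `D_𝔭`: `d⁻¹ τ d ∈ H` for `d ∈ D_𝔭`, `τ ∈ H`
  have hconj : ∀ d ∈ decomp 𝔭, ∀ τ ∈ H, d⁻¹ * τ * d ∈ H := by
    intro d hd τ hτ
    obtain ⟨hτD, hτk⟩ := Subgroup.mem_inf.mp hτ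
    refine Subgroup.mem_inf.mpr ⟨(decomp 𝔭).mul_mem ((decomp 𝔭).mul_mem ((decomp 𝔭).inv_mem hd) hτD) hd, ?_⟩
    rw [ZpExtension.mem_kerSubgroup] at hτk ⊢
    rw [map_mul, map_mul, map_inv, hτk, mul_one, inv_mul_cancel]
  -- hence the fixed module `B` is `D_𝔭`-stable
  have hBstab : ∀ d ∈ decomp 𝔭, ∀ {m : M}, m ∈ B → d • m ∈ B := by
    intro d hd m hm
    rw [hB, FixedPoints.mem_addSubgroup] at hm ⊢
    rintro ⟨τ, hτ⟩
    have h := hm ⟨d⁻¹ * τ * d, hconj d hd τ hτ⟩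
    rw [Subgroup.mk_smul] at h ⊢
    calc τ • d • m = d • ((d⁻¹ * τ * d) • m) := by rw [mul_smul, mul_smul, smul_inv_smul]
      _ = d • m := by rw [h]
  -- `M` and `B` are `p`-primary, `B[p]` is finite
  have htorM : ∀ x : M, ∃ k : ℕ, p ^ k • x = 0 := fun x ↦ by
    obtain ⟨k, hk⟩ := x.2
    exact ⟨k, Subtype.ext (by rw [AddSubgroupClass.coe_nsmul, hk]; rfl)⟩
  have hprimB : ∀ b : B, ∃ k : ℕ, p ^ k • b = 0 := fun b ↦ by
    obtain ⟨k, hk⟩ := htorM (b : M)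
    exact ⟨k, Subtype.ext (by rw [AddSubgroupClass.coe_nsmul, hk]; rfl)⟩
  haveI : Finite (E.geomTorsion ((p : ℕ) : ℤ)) :=
    E.finite_torsionPoints_holds (AlgebraicClosure K) (by exact_mod_cast hpr.ne_zero)
  haveI : Finite ((B)[(p : ℕ)]) := by
    refine Finite.of_injective (fun x : (B)[(p : ℕ)] ↦
      (⟨(((x : B) : M) : E.geomPoints), ?_⟩ : E.geomTorsion ((p : ℕ) : ℤ))) ?_
    · refine AddSubgroup.torsionBy.nsmul_iff.mpr ?_
      have h := congrArg (fun b : B ↦ ((b : M) : E.geomPoints))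
        (AddSubgroup.torsionBy.nsmul_iff.mp x.2)
      simpa only [AddSubmonoidClass.coe_nsmul, ZeroMemClass.coe_zero] using h
    · intro x y hxy
      have h := congrArg Subtype.val hxy
      dsimp only at h
      exact Subtype.ext (Subtype.ext (Subtype.ext h))
  -- the stable image `D₀ = p^{j₀} B`: infinite and `p`-divisible
  obtain ⟨j₀, hj₀⟩ := PrimaryGroup.exists_powRange_succ_eq p hprimB
  obtain ⟨t, ht⟩ := PrimaryGroup.exists_card_quotient_powRange_le p hprimB
  set D₀ : AddSubgroup B := (nsmulAddMonoidHom (p ^ j₀) : B →+ B).range with hD₀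
  have hD₀inf : ¬ Finite D₀ := by
    intro hfin
    apply hinfB
    haveI := (ht j₀).1
    refine Nat.finite_of_card_ne_zero ?_
    rw [← AddSubgroup.card_mul_index D₀, AddSubgroup.index_eq_card]
    exact mul_ne_zero Nat.card_pos.ne' Nat.card_pos.ne'
  have hdiv₀ : ∀ x ∈ D₀, ∃ y ∈ D₀, p • y = x := by
    rintro x hx
    have hx' : x ∈ (nsmulAddMonoidHom (p ^ (j₀ + 1)) : B →+ B).range := by rw [hj₀]; exact hx
    obtain ⟨c, rfl⟩ := hx'
    refine ⟨p ^ j₀ • c, ⟨c, rfl⟩, ?_⟩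
    change p • p ^ j₀ • c = p ^ (j₀ + 1) • c
    rw [pow_succ', mul_smul]
  -- push the stable image down to `M = E[p^∞]`
  set N : AddSubgroup M := D₀.map B.subtype with hN
  have hNdiv : ∀ c ∈ N, ∃ c' ∈ N, p • c' = c := by
    rintro _ ⟨b, hb, rfl⟩
    obtain ⟨c, hc, hcb⟩ := hdiv₀ b hb
    exact ⟨B.subtype c, ⟨c, hc, rfl⟩, by rw [← map_nsmul, hcb]⟩
  have hNstab : ∀ d ∈ decomp 𝔭, ∀ c ∈ N, d • c ∈ N := by
    rintro d hd _ ⟨b, ⟨c, rfl⟩, rfl⟩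
    set c' : B := ⟨d • (c : M), hBstab d hd c.2⟩ with hc'
    refine ⟨p ^ j₀ • c', ⟨c', rfl⟩, ?_⟩
    rw [map_nsmul, nsmulAddMonoidHom_apply, map_nsmul, smul_comm d (p ^ j₀) (B.subtype c)]
    rfl
  have hNfix : ∀ c ∈ N, ∀ g ∈ H, g • c = c := by
    rintro _ ⟨b, -, rfl⟩ g hg
    have hb : (b : M) ∈ FixedPoints.addSubgroup H M := b.2
    rw [FixedPoints.mem_addSubgroup] at hb
    have h := hb ⟨g, hg⟩
    rw [Subgroup.mk_smul] at h
    exact h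
  -- `N ≠ ⊤` by (ii)
  have hNtop : N ≠ ⊤ := by
    intro htop
    obtain ⟨m, -, g, hg, hne⟩ := hmove
    exact hne (hNfix m (by rw [htop]; exact AddSubgroup.mem_top m) g hg)
  -- so `#N[p] ≤ p`, and (i) kills `N`
  have hN1 : Set.ncard {c : E.geomPrimaryTorsion p | c ∈ N ∧ p • c = 0} ≤ p :=
    ncard_pTorsion_le_of_divisible_of_ne_top N htorM (ncard_geomPrimaryTorsion_pTorsion_eq_sq E)
      hNdiv hNtop
  have hNbot : N = ⊥ := hline N hNstab hNdiv hN1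
  apply hD₀inf
  haveI : Subsingleton D₀ := by
    refine ⟨fun x y ↦ Subtype.ext (B.subtype_injective ?_)⟩
    have hx : B.subtype (x : B) ∈ N := ⟨x, x.2, rfl⟩
    have hy : B.subtype (y : B) ∈ N := ⟨y, y.2, rfl⟩
    rw [hNbot, AddSubgroup.mem_bot] at hx hy
    rw [hx, hy]
  infer_instance

end WeierstrassCurve

end
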